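import Mathlib
import HarnessLib
import Literature.Analysis.FluidPDE.HelicityDensityWeightedBalance
import Literature.Analysis.FluidPDE.VorticityCalculus
import Literature.Analysis.FluidPDE.LocalBiotSavartCalculus
import Literature.Analysis.FluidPDE.VectorCalculusProofs
import Summits.NavierStokesRegularity.NavierStokesRegularity.Theorems.ChiralWindowDoorDefs

/-!
# Door S20 «ChiralWindowDoor» — the localised helicity identity of a classical solution in DISSIPATION FORM
# `d/dt h(a, v) = F_a(t) − 2 h(a, ω)` for a `C¹_c` weight (stub B3, step 1)

Door S20 of nsreg-p1's local Type-I door family (`HOME/ns-regularity-ideate-p1/r19/R19-LINE.md` §B3, line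
`r19/Sketch20v5.lean` 7f13084196f4f031; DESIGN-ONLY, route NOT born).  Stub B3 `stub_helicityBudget` integrates the
localised helicity identity over `(−∞, t₀]`.  The identity itself, for a classical unit-viscosity Navier–Stokes
solution `(v, q)` on the open backward time axis and a compactly supported `C¹` weight `a`
(`h(a, w) = locHelicity a w = ∫ a ⟪w, curl w⟫`, `ω = curl v`):

* `hasDerivAt_locHelicity` — the tree's windowed helicity budget
  (`IsClassicalNSSolutionOn.hasDerivAt_integral_mul_helicityDensity_of_contDiff_one`, Majda–Bertozzi Prop. 1.12 (iv)
  / Moffatt–Tsinober §2) read on `locHelicity`: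
  `d/dt h(a, v) = ∫⟪v,ω⟫(∇a·v) + ∫(q − ½|v|²)(∇a·ω) + ∫ a(⟪Δv, ω⟫ + ⟪v, Δω⟫)`;
* `integral_mul_laplacian_pair_eq` — **the viscous source in dissipation form**: for a divergence-free `C³` field
  `v` and a `C¹_c` weight, `∫ a(⟪Δv, ω⟫ + ⟪v, Δω⟫) = −2 h(a, ω) − ∫ ⟪curl ω, ∇a × v⟫`
  (`Δv = −curl ω`, `Δω = −curl curl ω` for divergence-free fields, tree `laplacian_eq_neg_curl_curl`; one curl
  integration by parts against the weight, tree `integral_mul_inner_curl_eq`; `∇a × v` is written basis-free as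
  `curlCLM ((fderiv ℝ a x).smulRight (v x))`);
* `hasDerivAt_locHelicity_dissipation` — **`d/dt h(a, v(t)) = F_a(t) − 2 h(a, ω(t))`** with the flux
  `F_a(t) = ∫⟪v,ω⟫(∇a·v) + ∫(q − ½|v|²)(∇a·ω) − ∫⟪curl ω, ∇a × v⟫` (every term carries `∇a`).

Seat nsreg-p6 g12 (THEOREMS-ONLY door sequels, DIRECTOR-NS g8 #32 (2)/#36).  WHAT THIS IS NOT: not NS regularity
(Clay A); not B3 yet (the Type-I flux bookkeeping and the integration over `(−∞,t₀]` are the next two files); an exact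
identity for smooth solutions; no route is opened.
-/

noncomputable section

-- the summit and its single sub-problem share the name (CONVENTIONS §1), as in every Theorems file
set_option linter.dupNamespace false

namespace Summit.NavierStokesRegularity.NavierStokesRegularity.Theorems.ChiralWindowDoorHelicityBudgetIdentity

open MeasureTheory Set Filter Topology Metric Function
open scoped RealInnerProductSpace Laplacian ContDiff
open Literature.Analysis Literature.Analysis.FluidPDE
open Summit.NavierStokesRegularity.NavierStokesRegularity.Theorems.ChiralWindowDoorDefs

variable {v : ℝ → EuclideanSpace ℝ (Fin 3) → EuclideanSpace ℝ (Fin 3)} {q : ℝ → EuclideanSpace ℝ (Fin 3) → ℝ}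
  {a : EuclideanSpace ℝ (Fin 3) → ℝ}

/-- **The windowed helicity identity on `locHelicity`**: for a classical unit-viscosity solution `(v, q)` on
`(−∞, 0)`, `t < 0` and a `C¹_c` weight `a`,
`d/dt h(a, v) = ∫⟪v,ω⟫(∇a·v) + ∫(q − ½|v|²)(∇a·ω) + ∫ a(⟪Δv, ω⟫ + ⟪v, Δω⟫)`. -/
theorem hasDerivAt_locHelicity (h : IsClassicalNSSolutionOn (Iio (0 : ℝ)) 1 0 v q) {t : ℝ} (ht : t < 0)
    (ha : ContDiff ℝ 1 a) (hac : HasCompactSupport a) :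
    HasDerivAt (fun s => locHelicity a (v s))
      ((∫ x, ⟪v t x, curl (v t) x⟫ * fderiv ℝ a x (v t x)) +
        (∫ x, (q t x - (1 / 2) * ‖v t x‖ ^ 2) * fderiv ℝ a x (curl (v t) x)) +
        ∫ x, a x * (⟪Δ (v t) x, curl (v t) x⟫ + ⟪v t x, Δ (curl (v t)) x⟫)) t := by
  have hD := h.hasDerivAt_integral_mul_helicityDensity_of_contDiff_one isOpen_Iio ht ha hac
  rw [one_mul] at hD
  exact hD

/-- **The viscous source in dissipation form.**  For a divergence-free `C³` field `v` on `ℝ³` with `ω = curl v` and a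
`C¹_c` weight `a`: `∫ a(⟪Δv, ω⟫ + ⟪v, Δω⟫) = −2 ∫ a⟪ω, curl ω⟫ − ∫ ⟪curl ω, ∇a × v⟫`. -/
theorem integral_mul_laplacian_pair_eq {w : EuclideanSpace ℝ (Fin 3) → EuclideanSpace ℝ (Fin 3)}
    (hw : ContDiff ℝ 3 w) (hdiv : VectorCalculus.IsDivFree w) (ha : ContDiff ℝ 1 a) (hac : HasCompactSupport a) :
    ∫ x, a x * (⟪Δ w x, curl w x⟫ + ⟪w x, Δ (curl w) x⟫) =
      -2 * locHelicity a (curl w) - ∫ x, ⟪curl (curl w) x, curlCLM ((fderiv ℝ a x).smulRight (w x))⟫ := by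
  -- regularity
  have hw2 : ContDiff ℝ 2 w := hw.of_le (by norm_cast)
  have hw1 : ContDiff ℝ 1 w := hw.of_le (by norm_cast)
  have hω2 : ContDiff ℝ 2 (curl w) := contDiff_curl (n := 2) (by exact_mod_cast hw)
  have hω1 : ContDiff ℝ 1 (curl w) := hω2.of_le (by norm_cast)
  have hωω1 : ContDiff ℝ 1 (curl (curl w)) := contDiff_curl (n := 1) (by exact_mod_cast hω2)
  have hdivω : VectorCalculus.IsDivFree (curl w) := fun x => divergence_curl_eq_zero_holds w hw2 x
  -- the two Laplacians through curls
  have hΔw : ∀ x, Δ w x = -curl (curl w) x := fun x => laplacian_eq_neg_curl_curl hw2 hdiv x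
  have hΔω : ∀ x, Δ (curl w) x = -curl (curl (curl w)) x := fun x => laplacian_eq_neg_curl_curl hω2 hdivω x
  -- integrability of the pieces (compactly supported continuous weight)
  have hc1 : Continuous fun x => a x * ⟪curl (curl w) x, curl w x⟫ :=
    ha.continuous.mul ((continuous_curl hω1).inner (continuous_curl hw1))
  have hc2 : Continuous fun x => a x * ⟪curl (curl w) x, w x⟫ :=
    ha.continuous.mul ((continuous_curl hω1).inner hw.continuous)
  have hI1 : Integrable fun x => a x * ⟪curl (curl w) x, curl w x⟫ := hc1.integrable_of_hasCompactSupport hac.mul_right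
  have hcc : Continuous fun x => a x * ⟪curl (curl (curl w)) x, w x⟫ :=
    ha.continuous.mul ((continuous_curl hωω1).inner hw.continuous)
  have hI3 : Integrable fun x => a x * ⟪curl (curl (curl w)) x, w x⟫ := hcc.integrable_of_hasCompactSupport hac.mul_right
  -- pointwise rewriting of the integrand
  have hpt : ∀ x, a x * (⟪Δ w x, curl w x⟫ + ⟪w x, Δ (curl w) x⟫) =
      -(a x * ⟪curl (curl w) x, curl w x⟫) - a x * ⟪curl (curl (curl w)) x, w x⟫ := fun x => by
    rw [hΔw x, hΔω x, inner_neg_left, inner_neg_right, real_inner_comm (curl (curl (curl w)) x)]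
    ring
  -- the curl integration by parts against the weight: `∫ a ⟪curl(curl ω), w⟫ = ∫ a ⟪curl ω, curl w⟫ + ∫⟪curl ω, ∇a × w⟫`
  have hibp := integral_mul_inner_curl_eq (F := curl (curl w)) (W := w) hωω1 hw1 ha hac
  -- `locHelicity a (curl w) = ∫ a ⟪curl w, curl curl w⟫ = ∫ a ⟪curl curl w, curl w⟫`
  have hhel : locHelicity a (curl w) = ∫ x, a x * ⟪curl (curl w) x, curl w x⟫ := by
    unfold locHelicity
    refine integral_congr_ae (Eventually.of_forall fun x => ?_)
    show a x * ⟪curl w x, curl (curl w) x⟫ = a x * ⟪curl (curl w) x, curl w x⟫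
    rw [real_inner_comm]
  have hI1' : Integrable fun x => -(a x * ⟪curl (curl w) x, curl w x⟫) := hI1.neg
  calc ∫ x, a x * (⟪Δ w x, curl w x⟫ + ⟪w x, Δ (curl w) x⟫)
      = ∫ x, (-(a x * ⟪curl (curl w) x, curl w x⟫) - a x * ⟪curl (curl (curl w)) x, w x⟫) :=
        integral_congr_ae (Eventually.of_forall hpt)
    _ = -(∫ x, a x * ⟪curl (curl w) x, curl w x⟫) - ∫ x, a x * ⟪curl (curl (curl w)) x, w x⟫ := by
        rw [integral_sub hI1' hI3, integral_neg]
    _ = _ := by rw [hibp, hhel]; ring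

/-- **The localised helicity identity in dissipation form** for a classical unit-viscosity solution `(v, q)` on
`(−∞,0)`, `t < 0`, and a `C¹_c` weight `a` (`ω = curl v`):
`d/dt h(a, v(t)) = ∫⟪v,ω⟫(∇a·v) + ∫(q − ½|v|²)(∇a·ω) − ∫⟪curl ω, ∇a × v⟫ − 2 h(a, ω(t))`. -/
theorem hasDerivAt_locHelicity_dissipation (h : IsClassicalNSSolutionOn (Iio (0 : ℝ)) 1 0 v q) {t : ℝ} (ht : t < 0)
    (ha : ContDiff ℝ 1 a) (hac : HasCompactSupport a) :
    HasDerivAt (fun s => locHelicity a (v s))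
      ((∫ x, ⟪v t x, curl (v t) x⟫ * fderiv ℝ a x (v t x)) +
        (∫ x, (q t x - (1 / 2) * ‖v t x‖ ^ 2) * fderiv ℝ a x (curl (v t) x)) -
        (∫ x, ⟪curl (curl (v t)) x, curlCLM ((fderiv ℝ a x).smulRight (v t x))⟫) -
        2 * locHelicity a (curl (v t))) t := by
  have hD := hasDerivAt_locHelicity h ht ha hac
  have hv3 : ContDiff ℝ 3 (v t) := contDiff_infty.1 (h.contDiff_velocity ht) 3
  rw [integral_mul_laplacian_pair_eq hv3 (h.divFree t ht) ha hac] at hD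
  refine hD.congr_deriv ?_
  ring

end Summit.NavierStokesRegularity.NavierStokesRegularity.Theorems.ChiralWindowDoorHelicityBudgetIdentity

end
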